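import Literature.MathematicalPhysics.QuantumFieldTheory.BalabanImbrieJaffe1984to88.BIJ88Eq5612W6

/-!
# `BalabanImbrieJaffe1984to88.BIJ88ExpansionAnyOrder287` — T. Bałaban, J. Imbrie, A. Jaffe, *Effective action and cluster properties of the
abelian Higgs model*, Commun. Math. Phys. **114** (1988) 257–315 [BalabanImbrieJaffe1988], Sect. 5.6 p. 287 [PDF 31], the sentence after
(5.6.11), verbatim: *"The terms in V_j are small (O(e_j^{1−α})), bounded kernels, either alone or applied to D_{ũ_{k+1}} or D*_{ũ_{k+1}}. Thus the
regularity properties of G_j(ũ_{k+1}), D_{ũ_{k+1}}G_j(ũ_{k+1}) imply that we can develop this expansion to any order."* — the second sentence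
PROVED as a two-sided first-order resolvent bootstrap: for `V = D*E₁ + E₂D + E₀` with `‖E_i‖ ≦ ε` (the structure and size of `V_j(Ω)` of this
seat's `BIJ88Vj5610Operator` p311248) and `G₀ = G_j(ũ_{k+1})` with the four regularity bounds `‖G₀‖, ‖DG₀‖, ‖G₀D*‖, ‖DG₀D*‖ ≦ c` (the printed
*"regularity properties of G_j(ũ_{k+1}), D_{ũ_{k+1}}G_j(ũ_{k+1})"* — the four norms of [6] = B4 Lemma 2.1), the Neumann expansion of (5.6.11)
`G = Σ_{n≦N}(G₀V)ⁿG₀ + (G₀V)^{N+1}G` has terms and remainder bounded by `2c·θⁿ`, `θ = 4cε`, in the norm `‖·‖ + ‖D·‖` — *"to any order"*.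

statement-level skeleton of published theorems with citation tags; proofs where landed; nothing here is a claim about the Yang–Mills mass gap

PDF held: `paper:balaban1988-cmp114-bij-abelian-higgs-effective-action` (journal page = PDF page + 256); p. 287 [PDF 31] read as an image this
session (seat folder `pages/original-p031-x2.png`).

CITATION HEADER (lean-in-tree rule).  Part of the lit-balaban TYPED SKELETON (HOME `run/shared/lean/pub/lit-balaban/`), PHASE-2 proof seat
p31 gen 10 (unit `lit-balaban-p31-g10`; fifth file of the 2026-08-22T00:11Z TAKING).  WHAT IS REPRODUCED: row `C2.Eq5.6.6-5.6.12` of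
`HOME/lit-balaban-r16/ROWS-C2-part2.md` (owner r16), the sentence quoted above (p. 287); the regularity input is [6] = T. Bałaban, *Regularity
and decay of lattice Green's functions*, CMP **89** (1983), Lemma 2.1 p. 577, verbatim (tree row `B4.Lem2.1`, `B4.Lemma21Printed`): *"‖G_k(□,A)f‖₂,
‖D^η_{A,μ}G_kf‖₂, ‖G_kD^{η*}_{A,μ}f‖₂, ‖D^η_{A,μ}G_kD^{η*}_{A,ν}f‖₂ ≦ c₂‖f‖₂"* — here the four bounds are HYPOTHESES on `G₀`; the abstract one-sided
version of this bootstrap for [6]'s Lemma 2.2 is the tree's `Balaban1983to89.B4Lemma22Reduce231` (real block matrices; not importable for the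
complex covariant operators here, so the two-sided complex form is proved afresh).

THE MECHANISM.  Work in the `ℓ^∞`-operator (max-row-sum) norm on complex matrices (Mathlib's scoped `Matrix.Norms.Operator`; rectangular
products are submultiplicative, `Matrix.linfty_opNorm_mul`) and measure a site-matrix `Y` by `Φ(Y) = ‖Y‖ + ‖DY‖` (`regPhi`).  For
`V = D*E₁ + E₂D + E₀`:  `G₀VY = (G₀D*)(E₁Y) + G₀(E₂(DY)) + G₀(E₀Y)` and `DG₀VY = (DG₀D*)(E₁Y) + (DG₀)(E₂(DY)) + (DG₀)(E₀Y)`, so the four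
regularity bounds and `‖E_i‖ ≦ ε` give `Φ(G₀VY) ≦ 2cε(2‖Y‖ + ‖DY‖) ≦ θΦ(Y)`, `θ = 4cε` (**`regPhi_step`**): the kernels *"applied to D*"* are
absorbed by `‖G₀D*‖`, those *"applied to D"* by `‖DY‖`, and the derivative of the result by `‖DG₀‖`, `‖DG₀D*‖`.  Hence `Φ((G₀V)ⁿY) ≦ θⁿΦ(Y)`
(`regPhi_pow`); the resolvent identity (5.6.11) `G = G₀ + G₀VG` gives `Φ(G) ≦ 2c + θΦ(G)`, i.e. `Φ(G) ≦ 2c/(1 − θ)` (**`regPhi_resolvent_le`**),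
the expansion `G = Σ_{n≦N}(G₀V)ⁿG₀ + (G₀V)^{N+1}G` to ANY order `N` (`expansion_anyOrder`) with `Φ((G₀V)ⁿG₀) ≦ 2cθⁿ` (`regPhi_term_le`) and
`Φ((G₀V)^{N+1}G) ≦ θ^{N+1}·2c/(1 − θ)` (**`regPhi_remainder_le`**).  §2 links to (5.6.10): `V_j(Ω) = D_u*E₁ + E₂D_u + E₀` with `E₁ = −χM`,
`E₂ = −M*χ`, `E₀ = −M*χM − a_j(Q*F₂ + F₂*Q + F₂*F₂)` (`vjMat_eq_firstOrder`), the row-sum size `‖M‖ ≦ 2|c|s` (`norm_mMat_le_op`, one entry per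
row, `0 ≦ s`), `‖χ_Ω‖ ≦ 1`, and the instantiated statement **`expansion_anyOrder_vj`** for the inverses of `BIJ88Vj5610Operator.hMat`.

WHAT IS PROVED (0 `sorry`, standard axioms; one definition with body (`regPhi`) + theorems, no `Prop` facts).
* §0 `norm_le_of_rowSums` (the max-row-sum norm is bounded by a uniform row-sum bound).
* §1 (abstract, complex matrices, sites `σ`, bonds `β`, any column type): `regPhi`, `regPhi_nonneg`, **`regPhi_step`**, `regPhi_pow`,
  **`regPhi_resolvent_le`**, `expansion_anyOrder`, `regPhi_term_le`, **`regPhi_remainder_le`**.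
* §2 (the operators of record): `vjMat_eq_firstOrder`, `norm_mMat_le_op`, `norm_chiN_le_one`, `norm_chiN_mul_mMat_le`, **`expansion_anyOrder_vj`**.
HONEST SCOPE.  The four regularity bounds on `G₀ = G_j(Ω, ũ_{k+1})` are DISPLAYED hypotheses in the shape of [6] Lemma 2.1 (row `B4.Lem2.1`, there
in `L²`/`L^∞` norms for the real vector-field Green's functions; the covariant scalar case is what print invokes), as are the kernel sizes `‖E_i‖ ≦ ε`
beyond the worked instance `‖χM‖ ≦ 2|c|s` (entrywise sizes: `BIJ88Vj5610Operator` §3, `BIJ88VjSmall287`); the norm is the max-row-sum operator norm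
(print's kernels are estimated by row sums); no statement about `w₆`/`w′₆` (file `BIJ88Eq5612W6`).  Unit `lit-balaban-p31` (literature-prover-lit-
balaban-p31-g10-0), 2026-08-22.  NOT summit progress.
-/

namespace Literature.MathematicalPhysics.QuantumFieldTheory.BalabanImbrieJaffe1984to88.BIJ88ExpansionAnyOrder287

open Literature.MathematicalPhysics.QuantumFieldTheory.Balaban1983to89
open BIJ88Sect3Statements (starB)
open BIJ88Sect5Statements (F1 norm_F1_le)
open BIJ88Vj5610Operator (dMat mMat qMat f2Mat chiN hMat vjMat eq5611_matrix norm_mMat_le)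
open scoped BigOperators Matrix Matrix.Norms.Operator NNReal
open Complex Matrix Finset

noncomputable section

/-! ## §0 The max-row-sum norm -/

/-- kernel: a uniform bound on the row sums `Σ_j‖A(i,j)‖ ≦ r` bounds the `ℓ^∞`-operator norm, `‖A‖ ≦ r` (Mathlib `Matrix.linfty_opNorm_def`).
[cite: BalabanImbrieJaffe1988, (5.6.11) p.287] -/
theorem norm_le_of_rowSums {m n : Type*} [Fintype m] [Fintype n] (A : Matrix m n ℂ) {r : ℝ} (hr : 0 ≤ r)
    (h : ∀ i, ∑ j, ‖A i j‖ ≤ r) : ‖A‖ ≤ r := by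
  rw [Matrix.linfty_opNorm_def]
  have key : (Finset.univ.sup fun i : m => ∑ j : n, ‖A i j‖₊) ≤ Real.toNNReal r := by
    refine Finset.sup_le fun i _ => ?_
    rw [← NNReal.coe_le_coe, Real.coe_toNNReal r hr]
    push_cast
    exact h i
  calc ((Finset.univ.sup fun i : m => ∑ j : n, ‖A i j‖₊ : ℝ≥0) : ℝ) ≤ (Real.toNNReal r : ℝ) := NNReal.coe_le_coe.mpr key
    _ = r := Real.coe_toNNReal r hr

/-! ## §1 The two-sided first-order bootstrap -/

section Abstract

variable {σ β : Type*} [Fintype σ] [Fintype β] [DecidableEq σ]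

/-- the regularity size of a site matrix `Y` relative to the covariant derivative `D`: `Φ(Y) = ‖Y‖ + ‖DY‖` (*"the regularity properties of G_j(ũ_{k+1}),
D_{ũ_{k+1}}G_j(ũ_{k+1})"*). [cite: BalabanImbrieJaffe1988, (5.6.11) p.287] -/
def regPhi {τ : Type*} [Fintype τ] (D : Matrix β σ ℂ) (Y : Matrix σ τ ℂ) : ℝ := ‖Y‖ + ‖D * Y‖

omit [DecidableEq σ] in
/-- kernel: `0 ≦ Φ(Y)`. [cite: BalabanImbrieJaffe1988, (5.6.11) p.287] -/
theorem regPhi_nonneg {τ : Type*} [Fintype τ] (D : Matrix β σ ℂ) (Y : Matrix σ τ ℂ) : 0 ≤ regPhi D Y :=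
  add_nonneg (norm_nonneg _) (norm_nonneg _)

variable {τ : Type*} [Fintype τ]

/-- **THE STEP**: for `V = D*E₁ + E₂D + E₀` — bounded kernels *"either alone or applied to D_{ũ_{k+1}} or D*_{ũ_{k+1}}"* with `‖E_i‖ ≦ ε` — and
`G₀` with `‖G₀‖, ‖DG₀‖, ‖G₀D*‖, ‖DG₀D*‖ ≦ c`: `Φ(G₀VY) ≦ 4cε·Φ(Y)` for every `Y`. [cite: BalabanImbrieJaffe1988, (5.6.11) p.287] -/
theorem regPhi_step {c ε : ℝ} (hc : 0 ≤ c) (hε : 0 ≤ ε) {G₀ E₀ : Matrix σ σ ℂ} {D E₁ : Matrix β σ ℂ} {Dst E₂ : Matrix σ β ℂ}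
    (hG₀ : ‖G₀‖ ≤ c) (hDG₀ : ‖D * G₀‖ ≤ c) (hG₀D : ‖G₀ * Dst‖ ≤ c) (hDG₀D : ‖D * G₀ * Dst‖ ≤ c)
    (h₁ : ‖E₁‖ ≤ ε) (h₂ : ‖E₂‖ ≤ ε) (h₀ : ‖E₀‖ ≤ ε) (Y : Matrix σ τ ℂ) :
    regPhi D (G₀ * (Dst * E₁ + E₂ * D + E₀) * Y) ≤ 4 * c * ε * regPhi D Y := by
  have hY := norm_nonneg Y
  have hDY := norm_nonneg (D * Y)
  -- the two algebraic expansions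
  have e1 : G₀ * (Dst * E₁ + E₂ * D + E₀) * Y = G₀ * Dst * (E₁ * Y) + G₀ * (E₂ * (D * Y)) + G₀ * (E₀ * Y) := by
    simp only [Matrix.mul_add, Matrix.add_mul, Matrix.mul_assoc]
  have e2 : D * (G₀ * (Dst * E₁ + E₂ * D + E₀) * Y) = D * G₀ * Dst * (E₁ * Y) + D * G₀ * (E₂ * (D * Y)) + D * G₀ * (E₀ * Y) := by
    simp only [Matrix.mul_add, Matrix.add_mul, Matrix.mul_assoc]
  -- the six norm bounds
  have b1 : ‖G₀ * Dst * (E₁ * Y)‖ ≤ c * (ε * ‖Y‖) :=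
    (linfty_opNorm_mul _ _).trans (mul_le_mul hG₀D ((linfty_opNorm_mul _ _).trans (mul_le_mul_of_nonneg_right h₁ hY))
      (norm_nonneg _) hc)
  have b2 : ‖G₀ * (E₂ * (D * Y))‖ ≤ c * (ε * ‖D * Y‖) :=
    (linfty_opNorm_mul _ _).trans (mul_le_mul hG₀ ((linfty_opNorm_mul _ _).trans (mul_le_mul_of_nonneg_right h₂ hDY))
      (norm_nonneg _) hc)
  have b3 : ‖G₀ * (E₀ * Y)‖ ≤ c * (ε * ‖Y‖) :=
    (linfty_opNorm_mul _ _).trans (mul_le_mul hG₀ ((linfty_opNorm_mul _ _).trans (mul_le_mul_of_nonneg_right h₀ hY))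
      (norm_nonneg _) hc)
  have b4 : ‖D * G₀ * Dst * (E₁ * Y)‖ ≤ c * (ε * ‖Y‖) :=
    (linfty_opNorm_mul _ _).trans (mul_le_mul hDG₀D ((linfty_opNorm_mul _ _).trans (mul_le_mul_of_nonneg_right h₁ hY))
      (norm_nonneg _) hc)
  have b5 : ‖D * G₀ * (E₂ * (D * Y))‖ ≤ c * (ε * ‖D * Y‖) :=
    (linfty_opNorm_mul _ _).trans (mul_le_mul hDG₀ ((linfty_opNorm_mul _ _).trans (mul_le_mul_of_nonneg_right h₂ hDY))
      (norm_nonneg _) hc)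
  have b6 : ‖D * G₀ * (E₀ * Y)‖ ≤ c * (ε * ‖Y‖) :=
    (linfty_opNorm_mul _ _).trans (mul_le_mul hDG₀ ((linfty_opNorm_mul _ _).trans (mul_le_mul_of_nonneg_right h₀ hY))
      (norm_nonneg _) hc)
  have n1 : ‖G₀ * (Dst * E₁ + E₂ * D + E₀) * Y‖ ≤ c * (ε * ‖Y‖) + c * (ε * ‖D * Y‖) + c * (ε * ‖Y‖) := by
    rw [e1]
    exact (norm_add_le _ _).trans (add_le_add ((norm_add_le _ _).trans (add_le_add b1 b2)) b3)
  have n2 : ‖D * (G₀ * (Dst * E₁ + E₂ * D + E₀) * Y)‖ ≤ c * (ε * ‖Y‖) + c * (ε * ‖D * Y‖) + c * (ε * ‖Y‖) := by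
    rw [e2]
    exact (norm_add_le _ _).trans (add_le_add ((norm_add_le _ _).trans (add_le_add b4 b5)) b6)
  unfold regPhi
  have hcε : 0 ≤ c * ε := mul_nonneg hc hε
  nlinarith

/-- kernel: iterating the step, `Φ((G₀V)ⁿY) ≦ (4cε)ⁿΦ(Y)`. [cite: BalabanImbrieJaffe1988, (5.6.11) p.287] -/
theorem regPhi_pow {c ε : ℝ} (hc : 0 ≤ c) (hε : 0 ≤ ε) {G₀ E₀ : Matrix σ σ ℂ} {D E₁ : Matrix β σ ℂ} {Dst E₂ : Matrix σ β ℂ}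
    (hG₀ : ‖G₀‖ ≤ c) (hDG₀ : ‖D * G₀‖ ≤ c) (hG₀D : ‖G₀ * Dst‖ ≤ c) (hDG₀D : ‖D * G₀ * Dst‖ ≤ c)
    (h₁ : ‖E₁‖ ≤ ε) (h₂ : ‖E₂‖ ≤ ε) (h₀ : ‖E₀‖ ≤ ε) (Y : Matrix σ τ ℂ) (n : ℕ) :
    regPhi D ((G₀ * (Dst * E₁ + E₂ * D + E₀)) ^ n * Y) ≤ (4 * c * ε) ^ n * regPhi D Y := by
  induction n with
  | zero => simp
  | succ n ih =>
    rw [pow_succ', Matrix.mul_assoc, pow_succ', mul_assoc]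
    calc regPhi D (G₀ * (Dst * E₁ + E₂ * D + E₀) * ((G₀ * (Dst * E₁ + E₂ * D + E₀)) ^ n * Y))
        ≤ 4 * c * ε * regPhi D ((G₀ * (Dst * E₁ + E₂ * D + E₀)) ^ n * Y) := regPhi_step hc hε hG₀ hDG₀ hG₀D hDG₀D h₁ h₂ h₀ _
      _ ≤ 4 * c * ε * ((4 * c * ε) ^ n * regPhi D Y) := mul_le_mul_of_nonneg_left ih (by positivity)

/-- **the resolvent bootstrap**: if `G = G₀ + G₀VG` ((5.6.11)) then `Φ(G) ≦ 2c/(1 − 4cε)` for `4cε < 1` — the perturbed propagator inherits the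
regularity of `G₀`. [cite: BalabanImbrieJaffe1988, (5.6.11) p.287] -/
theorem regPhi_resolvent_le {c ε : ℝ} (hc : 0 ≤ c) (hε : 0 ≤ ε) {G₀ G E₀ : Matrix σ σ ℂ} {D E₁ : Matrix β σ ℂ} {Dst E₂ : Matrix σ β ℂ}
    (hG₀ : ‖G₀‖ ≤ c) (hDG₀ : ‖D * G₀‖ ≤ c) (hG₀D : ‖G₀ * Dst‖ ≤ c) (hDG₀D : ‖D * G₀ * Dst‖ ≤ c)
    (h₁ : ‖E₁‖ ≤ ε) (h₂ : ‖E₂‖ ≤ ε) (h₀ : ‖E₀‖ ≤ ε) (hθ : 4 * c * ε < 1)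
    (h5611 : G = G₀ + G₀ * (Dst * E₁ + E₂ * D + E₀) * G) :
    regPhi D G ≤ 2 * c / (1 - 4 * c * ε) := by
  have hstep := regPhi_step hc hε hG₀ hDG₀ hG₀D hDG₀D h₁ h₂ h₀ G
  have e1 : ‖G‖ ≤ ‖G₀‖ + ‖G₀ * (Dst * E₁ + E₂ * D + E₀) * G‖ :=
    calc ‖G‖ = ‖G₀ + G₀ * (Dst * E₁ + E₂ * D + E₀) * G‖ := congrArg norm h5611
      _ ≤ ‖G₀‖ + ‖G₀ * (Dst * E₁ + E₂ * D + E₀) * G‖ := norm_add_le _ _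
  have e2 : ‖D * G‖ ≤ ‖D * G₀‖ + ‖D * (G₀ * (Dst * E₁ + E₂ * D + E₀) * G)‖ :=
    calc ‖D * G‖ = ‖D * (G₀ + G₀ * (Dst * E₁ + E₂ * D + E₀) * G)‖ := congrArg (fun X => ‖D * X‖) h5611
      _ = ‖D * G₀ + D * (G₀ * (Dst * E₁ + E₂ * D + E₀) * G)‖ := by rw [Matrix.mul_add]
      _ ≤ ‖D * G₀‖ + ‖D * (G₀ * (Dst * E₁ + E₂ * D + E₀) * G)‖ := norm_add_le _ _
  have hsplit : regPhi D G ≤ 2 * c + 4 * c * ε * regPhi D G := by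
    unfold regPhi at hstep ⊢
    linarith
  rw [le_div_iff₀ (by linarith)]
  linarith

/-- **the expansion to any order**: from (5.6.11) `G = G₀ + G₀VG`, for every `N`, `G = Σ_{n=0}^{N}(G₀V)ⁿG₀ + (G₀V)^{N+1}G` (*"we can develop this
expansion to any order"*). [cite: BalabanImbrieJaffe1988, (5.6.11) p.287] -/
theorem expansion_anyOrder {G₀ G V : Matrix σ σ ℂ} (h5611 : G = G₀ + G₀ * V * G) (N : ℕ) :
    G = (∑ n ∈ Finset.range (N + 1), (G₀ * V) ^ n * G₀) + (G₀ * V) ^ (N + 1) * G := by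
  induction N with
  | zero => simpa using h5611
  | succ N ih =>
    have key : (G₀ * V) ^ (N + 1) * G = (G₀ * V) ^ (N + 1) * G₀ + (G₀ * V) ^ (N + 1 + 1) * G := by
      conv_lhs => rw [h5611]
      rw [Matrix.mul_add, pow_succ (G₀ * V) (N + 1)]
      simp only [Matrix.mul_assoc]
    calc G = (∑ n ∈ Finset.range (N + 1), (G₀ * V) ^ n * G₀) + (G₀ * V) ^ (N + 1) * G := ih
      _ = _ := by
        rw [key]
        conv_rhs => rw [Finset.sum_range_succ]
        abel

/-- **the terms are geometrically small**: `Φ((G₀V)ⁿG₀) ≦ 2c·(4cε)ⁿ`. [cite: BalabanImbrieJaffe1988, (5.6.11) p.287] -/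
theorem regPhi_term_le {c ε : ℝ} (hc : 0 ≤ c) (hε : 0 ≤ ε) {G₀ E₀ : Matrix σ σ ℂ} {D E₁ : Matrix β σ ℂ} {Dst E₂ : Matrix σ β ℂ}
    (hG₀ : ‖G₀‖ ≤ c) (hDG₀ : ‖D * G₀‖ ≤ c) (hG₀D : ‖G₀ * Dst‖ ≤ c) (hDG₀D : ‖D * G₀ * Dst‖ ≤ c)
    (h₁ : ‖E₁‖ ≤ ε) (h₂ : ‖E₂‖ ≤ ε) (h₀ : ‖E₀‖ ≤ ε) (n : ℕ) :
    regPhi D ((G₀ * (Dst * E₁ + E₂ * D + E₀)) ^ n * G₀) ≤ 2 * c * (4 * c * ε) ^ n := by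
  have h := regPhi_pow hc hε hG₀ hDG₀ hG₀D hDG₀D h₁ h₂ h₀ G₀ n
  have hΦ : regPhi D G₀ ≤ 2 * c := by unfold regPhi; linarith
  calc regPhi D ((G₀ * (Dst * E₁ + E₂ * D + E₀)) ^ n * G₀) ≤ (4 * c * ε) ^ n * regPhi D G₀ := h
    _ ≤ (4 * c * ε) ^ n * (2 * c) := mul_le_mul_of_nonneg_left hΦ (by positivity)
    _ = 2 * c * (4 * c * ε) ^ n := by ring

/-- **the remainder is geometrically small**: `Φ((G₀V)^{N+1}G) ≦ (4cε)^{N+1}·2c/(1 − 4cε)`. [cite: BalabanImbrieJaffe1988, (5.6.11) p.287] -/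
theorem regPhi_remainder_le {c ε : ℝ} (hc : 0 ≤ c) (hε : 0 ≤ ε) {G₀ G E₀ : Matrix σ σ ℂ} {D E₁ : Matrix β σ ℂ} {Dst E₂ : Matrix σ β ℂ}
    (hG₀ : ‖G₀‖ ≤ c) (hDG₀ : ‖D * G₀‖ ≤ c) (hG₀D : ‖G₀ * Dst‖ ≤ c) (hDG₀D : ‖D * G₀ * Dst‖ ≤ c)
    (h₁ : ‖E₁‖ ≤ ε) (h₂ : ‖E₂‖ ≤ ε) (h₀ : ‖E₀‖ ≤ ε) (hθ : 4 * c * ε < 1)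
    (h5611 : G = G₀ + G₀ * (Dst * E₁ + E₂ * D + E₀) * G) (N : ℕ) :
    regPhi D ((G₀ * (Dst * E₁ + E₂ * D + E₀)) ^ (N + 1) * G) ≤ (4 * c * ε) ^ (N + 1) * (2 * c / (1 - 4 * c * ε)) :=
  (regPhi_pow hc hε hG₀ hDG₀ hG₀D hDG₀D h₁ h₂ h₀ G (N + 1)).trans
    (mul_le_mul_of_nonneg_left (regPhi_resolvent_le hc hε hG₀ hDG₀ hG₀D hDG₀D h₁ h₂ h₀ hθ h5611) (by positivity))

end Abstract

/-! ## §2 The operators of record -/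

section Concrete

variable {P : Params} {j : ℕ} {τ : Type*} [Fintype τ]

/-- **`V_j(Ω)` is first order**: `V_j(Ω) = D_u*E₁ + E₂D_u + E₀` with `E₁ = −χM`, `E₂ = −M*χ`, `E₀ = −M*χM − a_j(Q*F₂ + F₂*Q + F₂*F₂)` — the COMPUTED
`vjMat` of this seat's `BIJ88Vj5610Operator` regrouped (*"bounded kernels, either alone or applied to D_{ũ_{k+1}} or D*_{ũ_{k+1}}"*).
[cite: BalabanImbrieJaffe1988, (5.6.10) p.287] -/
theorem vjMat_eq_firstOrder (aj c : ℝ) (u a : PBond P j → ℂ) (χ : Matrix (PBond P j) (PBond P j) ℂ)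
    (B : τ → Finset (Balaban1983to89.Site P j)) (w : ℝ) (U A : τ → Balaban1983to89.Site P j → ℂ) :
    vjMat aj c u a χ B w U A
      = (dMat c u)ᴴ * (-(χ * mMat c u a)) + (-((mMat c u a)ᴴ * χ)) * dMat c u
        + (-((mMat c u a)ᴴ * χ * mMat c u a)
          - (aj : ℂ) • ((qMat B w U)ᴴ * f2Mat B w U A + (f2Mat B w U A)ᴴ * qMat B w U + (f2Mat B w U A)ᴴ * f2Mat B w U A)) := by
  simp only [vjMat, Matrix.mul_neg, Matrix.neg_mul, Matrix.mul_assoc]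
  abel

/-- **the (5.6.9) kernel in the max-row-sum norm**: one entry per row, so `‖M‖ ≦ |c|·2s` for `|u| ≦ 1`, `‖a‖ ≦ s ≦ 1`.
[cite: BalabanImbrieJaffe1988, (5.6.11) p.287] -/
theorem norm_mMat_le_op {c s : ℝ} {u a : PBond P j → ℂ} (hu : ∀ b, ‖u b‖ ≤ 1) (ha : ∀ b, ‖a b‖ ≤ s) (hs0 : 0 ≤ s) (hs : s ≤ 1) :
    ‖mMat c u a‖ ≤ |c| * (2 * s) := by
  refine norm_le_of_rowSums _ (by positivity) fun b => ?_
  have hrow : ∑ x, ‖mMat c u a b x‖ = ‖(c : ℂ) * u b * F1 (a b)‖ := by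
    simp only [mMat, Matrix.of_apply, apply_ite norm, norm_zero, Finset.sum_ite_eq', Finset.mem_univ, if_true]
  rw [hrow]
  have := norm_mMat_le (c := c) (hu b) (ha b) hs b.tgt
  simpa [mMat] using this

open Classical in
/-- kernel: the Neumann cut-off has norm at most one. [cite: BalabanImbrieJaffe1988, (5.6.10) p.287] -/
theorem norm_chiN_le_one (Ω : Finset (Balaban1983to89.Site P j)) : ‖chiN Ω‖ ≤ 1 := by
  refine norm_le_of_rowSums _ zero_le_one fun b => ?_
  simp only [chiN, Matrix.diagonal_apply, apply_ite norm, norm_one, norm_zero]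
  rw [Finset.sum_ite_eq]
  simp only [Finset.mem_univ, if_true]
  split_ifs <;> norm_num

/-- kernel: `‖E₁‖ = ‖χ_ΩM‖ ≦ 2|c|s` — the worked instance of the kernel size in operator norm. [cite: BalabanImbrieJaffe1988, (5.6.11) p.287] -/
theorem norm_chiN_mul_mMat_le (Ω : Finset (Balaban1983to89.Site P j)) {c s : ℝ} {u a : PBond P j → ℂ} (hu : ∀ b, ‖u b‖ ≤ 1)
    (ha : ∀ b, ‖a b‖ ≤ s) (hs0 : 0 ≤ s) (hs : s ≤ 1) : ‖-(chiN Ω * mMat c u a)‖ ≤ |c| * (2 * s) := by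
  rw [norm_neg]
  calc ‖chiN Ω * mMat c u a‖ ≤ ‖chiN Ω‖ * ‖mMat c u a‖ := linfty_opNorm_mul _ _
    _ ≤ 1 * (|c| * (2 * s)) := mul_le_mul (norm_chiN_le_one Ω) (norm_mMat_le_op hu ha hs0 hs) (norm_nonneg _) zero_le_one
    _ = |c| * (2 * s) := one_mul _

/-- **«we can develop this expansion to any order» for the operators of record**: `G₀ = G_j(Ω, ũ_{k+1})`, `G = G_j(Ω, ũ_{k+1}ũ)` the inverses of
`BIJ88Vj5610Operator.hMat` at `u` and at `ue^a` (so (5.6.11) holds, `eq5611_matrix`), the four regularity bounds of [6] Lemma 2.1 on `G₀` with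
`D = D_u`, `D* = D_uᴴ`, and the kernel sizes `‖χM‖, ‖M*χ‖, ‖E₀‖ ≦ ε` with `4cε < 1` ⟹ the expansion to every order `N` with terms `≦ 2c(4cε)ⁿ` and
remainder `≦ (4cε)^{N+1}·2c/(1−4cε)` in the size `‖·‖ + ‖D_u·‖`. [cite: BalabanImbrieJaffe1988, (5.6.11) p.287] -/
theorem expansion_anyOrder_vj (aj c₀ : ℝ) (u a : PBond P j → ℂ) (χ : Matrix (PBond P j) (PBond P j) ℂ)
    (B : τ → Finset (Balaban1983to89.Site P j)) (w : ℝ) (U A : τ → Balaban1983to89.Site P j → ℂ)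
    {G₀ G : Matrix (Balaban1983to89.Site P j) (Balaban1983to89.Site P j) ℂ} (hG₀inv : G₀ * hMat aj c₀ u χ B w U = 1)
    (hGinv : hMat aj c₀ (fun b => u b * exp (a b)) χ B w (fun y x => U y x * exp (A y x)) * G = 1)
    {c ε : ℝ} (hc : 0 ≤ c) (hε : 0 ≤ ε) (hG₀ : ‖G₀‖ ≤ c) (hDG₀ : ‖dMat c₀ u * G₀‖ ≤ c) (hG₀D : ‖G₀ * (dMat c₀ u)ᴴ‖ ≤ c)
    (hDG₀D : ‖dMat c₀ u * G₀ * (dMat c₀ u)ᴴ‖ ≤ c) (h₁ : ‖-(χ * mMat c₀ u a)‖ ≤ ε) (h₂ : ‖-((mMat c₀ u a)ᴴ * χ)‖ ≤ ε)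
    (h₀ : ‖-((mMat c₀ u a)ᴴ * χ * mMat c₀ u a)
          - (aj : ℂ) • ((qMat B w U)ᴴ * f2Mat B w U A + (f2Mat B w U A)ᴴ * qMat B w U + (f2Mat B w U A)ᴴ * f2Mat B w U A)‖ ≤ ε)
    (hθ : 4 * c * ε < 1) (N : ℕ) :
    G = (∑ n ∈ Finset.range (N + 1), (G₀ * vjMat aj c₀ u a χ B w U A) ^ n * G₀) + (G₀ * vjMat aj c₀ u a χ B w U A) ^ (N + 1) * G
      ∧ (∀ n, regPhi (dMat c₀ u) ((G₀ * vjMat aj c₀ u a χ B w U A) ^ n * G₀) ≤ 2 * c * (4 * c * ε) ^ n)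
      ∧ regPhi (dMat c₀ u) ((G₀ * vjMat aj c₀ u a χ B w U A) ^ (N + 1) * G) ≤ (4 * c * ε) ^ (N + 1) * (2 * c / (1 - 4 * c * ε)) := by
  have h5611 := eq5611_matrix aj c₀ u a χ B w U A hG₀inv hGinv
  refine ⟨expansion_anyOrder h5611 N, fun n => ?_, ?_⟩
  · rw [vjMat_eq_firstOrder]
    exact regPhi_term_le hc hε hG₀ hDG₀ hG₀D hDG₀D h₁ h₂ h₀ n
  · rw [vjMat_eq_firstOrder] at h5611 ⊢
    exact regPhi_remainder_le hc hε hG₀ hDG₀ hG₀D hDG₀D h₁ h₂ h₀ hθ h5611 N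

end Concrete

end

end Literature.MathematicalPhysics.QuantumFieldTheory.BalabanImbrieJaffe1984to88.BIJ88ExpansionAnyOrder287
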